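import Literature.AnabelianGeometry.SemiGraphs.TemperedFunctorialityProofs
import Literature.AnabelianGeometry.SemiGraphs.ChartFibreCompletion
import HarnessLib

/-!
# Coverings pulled back from ONE group along a compatible family of homomorphisms
# ([SemiAnbd] §3 p. 36 `B^cov(G)`, Def. 3.5 (i)(ii) p. 37; Rmk. 3.1.2 pp. 33–34 restriction of scalars)

Mochizuki, *Semi-graphs of anabelioids*, Publ. RIMS **42** (2006), §3: p. 36 (the category `B^cov(G)`: "a countable
discrete continuous `Π_v`-set `S_v` for every vertex, … `S_e` for every edge, and gluing isomorphisms `S_e ≅ b^* S_v`"),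
Def. 3.5 (i)(ii) p. 37 (coverings, finite and tempered coverings), Rmk. 3.1.2 pp. 33–34 ("any continuous homomorphism
`Π → Π'` determines [by composing the action …] a morphism `B^temp(Π) → B^temp(Π')`")
[cite: MochizukiSemiAnbd2006, §3 p.36] [cite: MochizukiSemiAnbd2006, Def 3.5(i) p.37].

DEFINITIONS file (abc-iut cell, layer L3 [SemiAnbd], block-F seat abc-iut-f-169 gen 4; FACT-LIST row F-2772
`ProfiniteSemiGraph.EdgeLikeCentralizerAt`, L3-lead row «F2772-INSTANCE@HOSTABLE-CORE» δ56 (2), SHAPES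
6bbfce0e227dee9a §3 FILE 2, G13 announced 2026-08-27T10:33Z).  The «kill the graph» retraction of a graph of
groups with CONSTANT gluing data (abc-iut-f-176 gen 6's memo FINDING-hostable-types-residual §3: "every vertex group
`↦ G` identically, stable letters `↦ 1` — well defined BECAUSE the two branch maps of each edge agree") is recorded
at the level where the tree can use it — coverings, not the (abstract) tempered fundamental group:

* `ProfiniteSemiGraph.HomToGroup ℋ G` — a COMPATIBLE FAMILY of continuous homomorphisms from the constituent
  groups of `ℋ` to one topological group `G`: `Φ_v : Π_v → G`, `Φ_e : Π_e → G` with `Φ_v ∘ b_* = Φ_e` for every branch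
  `b` of `e` abutting to `v`.  (Constant gluing data = the case where the `Φ_v` are isomorphisms; nothing here
  requires that.)
* `HomToGroup.glueIso` — the two restrictions of scalars `B^temp(Φ_e)` and `B^temp(b_*) ∘ B^temp(Φ_v)` agree
  (conjugator `1`, `BTemp.resIsoOfConj`, composed with `BTemp.resComp`);
* `HomToGroup.pullback Φ : B^temp(G) ⥤ B^cov(ℋ)` — the covering of `ℋ` PULLED BACK from a `G`-set `Y`: over `v` the
  `Π_v`-set `Y|_{Φ_v}`, over `e` the `Π_e`-set `Y|_{Φ_e}`, identity gluings (legitimate by compatibility) — the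
  non-trivial-action twin of abc-iut-L3-t2's `CovObj.trivialCov` (which is `pullback` of the trivial family);
  definitional laws `pullback_obj_SV/SE`, `pullback_ρV/ρE_apply`, `pullback_map_fV/fE_apply`, `pullback_glue_apply`;
* `isFinite_pullback_obj`, `hasNonemptyFibres_pullback_obj`, and — BY NAME from abc-iut-L3's
  `isTempered_of_isFinite_of_prop36` — `isTempered_pullback_obj_of_prop36`: pulled-back FINITE `G`-sets are tempered
  coverings under the hypotheses of Prop. 3.6; packaged as the object `pullbackTemp` of `B^temp(ℋ)` with its
  morphisms `pullbackTempMap` (the DECK TRANSFORMATIONS of the sequel: for `Y = G/N` and `G`-endomorphisms of `G/N`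
  by right translation).

USE (sequel, PROOF-ONLY `TemperedEdgeLikeCentralizerOfHomToGroup.lean`): the covering-separation criterion
`edgeLikeCentralizerAt_of_coveringSeparated` (abc-iut-f-169, p523783) fed with `pullbackTemp Φ (G/N)`: a
deck-equivariant bijection `G/N ≃ G/N` is a LEFT translation, so hostability of a far edge `e′` for the piece
`ψ_e(U)` forces `h·Φ_e(U)·h⁻¹ ≤ Φ_{e′}(Π_{e′})·N` for every open normal `N ⊴ G` — separation IN `G` at one finite level
refutes it.

Definitions + definitional laws + the finiteness/temperedness lemmas; no `instance`, no notation, no `Prop` fact, no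
statement of the paper is retyped or altered.  Honest framing: a bookkeeping construction over the tree's `B^cov`;
nothing here takes a side on [IUTchIII] Cor. 3.12; typed ≠ proved.
-/

noncomputable section

namespace Literature.AnabelianGeometry.SemiGraphs

namespace ProfiniteSemiGraph

open CategoryTheory Topology
open Literature.AlgebraicGeometry.Frobenioids.QuasiTemperoid.BTempConnected (ρ_one_apply)

universe u

variable (ℋ : ProfiniteSemiGraph.{u}) (G : Type u) [Group G] [TopologicalSpace G]

/-- **A compatible family of continuous homomorphisms to one group** ("kill the graph"): continuous
`Φ_v : Π_v → G` for every vertex and `Φ_e : Π_e → G` for every edge with `Φ_v ∘ b_* = Φ_e` for every branch `b` of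
`e` abutting to `v` — i.e. a morphism from the graph of profinite groups underlying `ℋ` ([SemiAnbd] p. 23 "semi-graph
of profinite groups") to the constant one-group diagram.  Constant gluing data (all `Π_v ≅ G`, both branch maps of
each edge one embedding) is the case of bijective `Φ_v`. A DEFINITION; nothing of the paper is asserted.
[cite: MochizukiSemiAnbd2006, Def 2.1 p.23] -/
structure HomToGroup : Type u where
  /-- the vertex homomorphisms `Φ_v : Π_v → G` -/
  fv : ∀ v : ℋ.graph.Vertex, ℋ.Gv v →ₜ* G
  /-- the edge homomorphisms `Φ_e : Π_e → G` -/
  fe : ∀ e : ℋ.graph.Edge, ℋ.Ge e →ₜ* G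
  /-- compatibility along every abutting branch: `Φ_v (b_* γ) = Φ_e γ` -/
  comm : ∀ (b : ℋ.graph.Branch) (v : ℋ.graph.Vertex) (h : ℋ.graph.abuts b = some v)
    (γ : ℋ.Ge (ℋ.graph.edgeOf b)), fv v (ℋ.brHom b v h γ) = fe (ℋ.graph.edgeOf b) γ

namespace HomToGroup

variable {ℋ G} (Φ : HomToGroup ℋ G)

/-- The gluing behind the pulled-back coverings, as a natural isomorphism of restriction-of-scalars functors
`B^temp(Φ_e) ≅ B^temp(Φ_v) ⋙ B^temp(b_*)` (both are restriction along the same homomorphism `Φ_e = Φ_v ∘ b_*`;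
conjugator `1`). [cite: MochizukiSemiAnbd2006, Rmk 3.1.2 pp.33-34] -/
def glueIso (b : ℋ.graph.Branch) (v : ℋ.graph.Vertex) (h : ℋ.graph.abuts b = some v) :
    BTemp.res (Φ.fe (ℋ.graph.edgeOf b)) ≅ BTemp.res (Φ.fv v) ⋙ BTemp.res (ℋ.brHom b v h) :=
  BTemp.resIsoOfConj (Φ.fe (ℋ.graph.edgeOf b)) ((Φ.fv v).comp (ℋ.brHom b v h)) 1 (fun γ => by
      rw [one_mul, inv_one, mul_one, ContinuousMonoidHom.comp_toFun, Φ.comm]) ≪≫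
    (BTemp.resComp (Φ.fv v) (ℋ.brHom b v h)).symm

/-- Underlying map of the gluing: the identity (it is "act by `1`").
[cite: MochizukiSemiAnbd2006, Rmk 3.1.2 pp.33-34] -/
theorem glueIso_hom_app_apply (b : ℋ.graph.Branch) (v : ℋ.graph.Vertex) (h : ℋ.graph.abuts b = some v)
    (Y : BTemp G) (y : Y.obj.V) : ((Φ.glueIso b v h).hom.app Y).hom.hom y = y := by
  change Y.obj.ρ 1 y = y
  exact ρ_one_apply Y y

/-- **The covering of `ℋ` pulled back from a `G`-set** `Y ∈ B^temp(G)`: over `v` the `Π_v`-set `Y|_{Φ_v}`, over `e`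
the `Π_e`-set `Y|_{Φ_e}`, glued by `glueIso` (identity maps).  An object of `B^cov(ℋ)` ([SemiAnbd] §3 p. 36).
[cite: MochizukiSemiAnbd2006, §3 p.36] -/
def pullbackObj (Y : BTemp G) : CovObj ℋ where
  SV v := (BTemp.res (Φ.fv v)).obj Y
  SE e := (BTemp.res (Φ.fe e)).obj Y
  glue b v h := (Φ.glueIso b v h).app Y

/-- The pull-back of a `G`-map: the same map over every vertex and edge; compatibility with the gluings is the
naturality of `glueIso`. [cite: MochizukiSemiAnbd2006, §3 p.36] -/
def pullbackMap {Y Y' : BTemp G} (f : Y ⟶ Y') : Φ.pullbackObj Y ⟶ Φ.pullbackObj Y' where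
  fV v := (BTemp.res (Φ.fv v)).map f
  fE e := (BTemp.res (Φ.fe e)).map f
  comm b v h := (Φ.glueIso b v h).hom.naturality f

/-- **The pull-back functor `B^temp(G) ⥤ B^cov(ℋ)` along a compatible family `Φ`** (the covering-level form of
"every vertex group `↦ G`, stable letters `↦ 1`"). [cite: MochizukiSemiAnbd2006, §3 p.36] -/
def pullback : BTemp G ⥤ CovObj ℋ where
  obj Y := Φ.pullbackObj Y
  map f := Φ.pullbackMap f
  map_id Y := by
    refine CovHom.ext ?_ ?_ <;> funext _
    · exact (BTemp.res _).map_id _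
    · exact (BTemp.res _).map_id _
  map_comp f g := by
    refine CovHom.ext ?_ ?_ <;> funext _
    · exact (BTemp.res _).map_comp _ _
    · exact (BTemp.res _).map_comp _ _

/-- Vertex fibres of a pulled-back covering: `Y|_{Φ_v}` (definitional). [cite: MochizukiSemiAnbd2006, §3 p.36] -/
@[simp] theorem pullback_obj_SV (Y : BTemp G) (v : ℋ.graph.Vertex) :
    (Φ.pullback.obj Y).SV v = (BTemp.res (Φ.fv v)).obj Y := rfl

/-- Edge fibres of a pulled-back covering: `Y|_{Φ_e}` (definitional). [cite: MochizukiSemiAnbd2006, §3 p.36] -/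
@[simp] theorem pullback_obj_SE (Y : BTemp G) (e : ℋ.graph.Edge) :
    (Φ.pullback.obj Y).SE e = (BTemp.res (Φ.fe e)).obj Y := rfl

/-- The `Π_v`-action on the vertex fibre is the `G`-action through `Φ_v` (definitional).
[cite: MochizukiSemiAnbd2006, §3 p.36] -/
theorem pullback_ρV_apply (Y : BTemp G) (v : ℋ.graph.Vertex) (γ : ℋ.Gv v) (y : Y.obj.V) :
    ((Φ.pullback.obj Y).SV v).obj.ρ γ y = Y.obj.ρ (Φ.fv v γ) y := rfl

/-- The `Π_e`-action on the edge fibre is the `G`-action through `Φ_e` (definitional).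
[cite: MochizukiSemiAnbd2006, §3 p.36] -/
theorem pullback_ρE_apply (Y : BTemp G) (e : ℋ.graph.Edge) (γ : ℋ.Ge e) (y : Y.obj.V) :
    ((Φ.pullback.obj Y).SE e).obj.ρ γ y = Y.obj.ρ (Φ.fe e γ) y := rfl

/-- Vertex components of pulled-back maps are the given map (definitional). [cite: MochizukiSemiAnbd2006, §3 p.36] -/
theorem pullback_map_fV_apply {Y Y' : BTemp G} (f : Y ⟶ Y') (v : ℋ.graph.Vertex) (y : Y.obj.V) :
    ((Φ.pullback.map f).fV v).hom.hom y = f.hom.hom y := rfl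

/-- Edge components of pulled-back maps are the given map (definitional). [cite: MochizukiSemiAnbd2006, §3 p.36] -/
theorem pullback_map_fE_apply {Y Y' : BTemp G} (f : Y ⟶ Y') (e : ℋ.graph.Edge) (y : Y.obj.V) :
    ((Φ.pullback.map f).fE e).hom.hom y = f.hom.hom y := rfl

/-- The gluings of a pulled-back covering are identity maps. [cite: MochizukiSemiAnbd2006, §3 p.36] -/
theorem pullback_glue_apply (Y : BTemp G) (b : ℋ.graph.Branch) (v : ℋ.graph.Vertex)
    (h : ℋ.graph.abuts b = some v) (y : Y.obj.V) :
    ((Φ.pullback.obj Y).glue b v h).hom.hom.hom y = y :=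
  Φ.glueIso_hom_app_apply b v h Y y

/-- A pulled-back FINITE `G`-set is a finite covering (Def. 3.5 (i)). [cite: MochizukiSemiAnbd2006, Def 3.5(i) p.37] -/
theorem isFinite_pullback_obj (Y : BTemp G) [Finite Y.obj.V] : (Φ.pullback.obj Y).IsFinite :=
  ⟨fun _ => inferInstanceAs (Finite Y.obj.V), fun _ => inferInstanceAs (Finite Y.obj.V)⟩

/-- A pulled-back NONEMPTY `G`-set has nonempty fibres. [cite: MochizukiSemiAnbd2006, Def 3.5(i) p.37] -/
theorem hasNonemptyFibres_pullback_obj (Y : BTemp G) [Nonempty Y.obj.V] : (Φ.pullback.obj Y).HasNonemptyFibres :=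
  ⟨fun _ => inferInstanceAs (Nonempty Y.obj.V), fun _ => inferInstanceAs (Nonempty Y.obj.V)⟩

/-- Under the hypotheses of Prop. 3.6 a pulled-back finite `G`-set is a TEMPERED covering (finite objects are
tempered, abc-iut-L3's `isTempered_of_isFinite_of_prop36` BY NAME). [cite: MochizukiSemiAnbd2006, Def 3.5(ii) p.37] -/
theorem isTempered_pullback_obj_of_prop36 (h36 : ℋ.Prop36Hypotheses) (Y : BTemp G) [Finite Y.obj.V] :
    (Φ.pullback.obj Y).IsTempered :=
  isTempered_of_isFinite_of_prop36 h36 _ (Φ.isFinite_pullback_obj Y)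

/-- The pulled-back finite `G`-set as an object of `B^temp(ℋ)` (under the hypotheses of Prop. 3.6).
[cite: MochizukiSemiAnbd2006, Def 3.5(ii) p.37] -/
def pullbackTemp (h36 : ℋ.Prop36Hypotheses) (Y : BTemp G) [Finite Y.obj.V] : BTempCat ℋ :=
  ⟨Φ.pullback.obj Y, Φ.isTempered_pullback_obj_of_prop36 h36 Y⟩

/-- The underlying covering of `pullbackTemp` (definitional). [cite: MochizukiSemiAnbd2006, Def 3.5(ii) p.37] -/
@[simp] theorem pullbackTemp_obj (h36 : ℋ.Prop36Hypotheses) (Y : BTemp G) [Finite Y.obj.V] :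
    (Φ.pullbackTemp h36 Y).obj = Φ.pullback.obj Y := rfl

/-- Pulled-back `G`-maps between finite `G`-sets as morphisms of `B^temp(ℋ)` (a full subcategory of `B^cov(ℋ)`);
for `Y = Y'` these are the deck transformations used by the sequel. [cite: MochizukiSemiAnbd2006, Def 3.5(ii) p.37] -/
def pullbackTempMap (h36 : ℋ.Prop36Hypotheses) {Y Y' : BTemp G} [Finite Y.obj.V] [Finite Y'.obj.V] (f : Y ⟶ Y') :
    Φ.pullbackTemp h36 Y ⟶ Φ.pullbackTemp h36 Y' :=
  ObjectProperty.homMk (Φ.pullback.map f)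

/-- The underlying `B^cov`-morphism of `pullbackTempMap` (definitional). [cite: MochizukiSemiAnbd2006, Def 3.5(ii) p.37] -/
@[simp] theorem pullbackTempMap_hom (h36 : ℋ.Prop36Hypotheses) {Y Y' : BTemp G} [Finite Y.obj.V] [Finite Y'.obj.V]
    (f : Y ⟶ Y') : (Φ.pullbackTempMap h36 f).hom = Φ.pullback.map f := rfl

end HomToGroup

end ProfiniteSemiGraph

end Literature.AnabelianGeometry.SemiGraphs
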